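import Mathlib.NumberTheory.Transcendental.Liouville.LiouvilleWith
import Mathlib.Analysis.SpecialFunctions.Trigonometric.Basic
import HarnessLib

/-!
# The record irrationality measure of `π` (Zeilberger–Zudilin 2020)

Topic `Literature/NumberTheory/Irrationality/ZeilbergerZudilin2020`. Typed, cited statement (no
proof) of the main result of D. Zeilberger, W. Zudilin, *The irrationality measure of `π` is at most
`7.103205334137…`*, Moscow J. Comb. Number Theory **9**:4 (2020) 407–419 = arXiv:1912.06345
[ZeilbergerZudilin2020]: `μ(π) ≤ 7.10320533413700172…`. PRIMARY SOURCE read on the page (held: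
`paper:arxiv-1912.06345`): Abstract — "We use a variant of Salikhov's ingenious proof that the
irrationality measure of `π` is at most `7.606308…` to prove that, in fact, it is at most
`7.103205334137…`"; §1 — "we define (see [Wei]) the irrationality measure `μ` (also called the
irrationality exponent) as the smallest number `μ` such that `|x − p/q| > 1/q^{μ+ε}` holds for any
`ε > 0` and all integers `p` and `q` with sufficiently large `q`"; final section "World record" —
the forms `I'_n = a'_n + b'_n π` with integral coefficients have
`lim log|I'_n|/n = −1.90291648559998…`, `lim log b_n/n = 11.613890045331…`, and "This implies (see,
e.g., [Sal10]) that the irrationality measure of `π` is bounded above by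
`1 + 11.613890045331…/1.90291648559998… = 7.10320533413700172750577342281…`." Previous record quoted
there: Salikhov 2008/2010, `7.606308`.

Rendering (as in `RhinViola2001/ZetaThreeMeasure.lean`, `Zudilin2014/ZetaTwoMeasure.lean`):
`μ(x) ≤ c` implies `¬ LiouvilleWith p x` for every `p > c`; the constant below is the printed one
rounded UP in the last digit (`7.103205334138 > 7.103205334137001…`), so the typed statement is
implied by the printed one.

Cell pub-zeta5 (HONEST FRAMING: systematic search; no irrationality claim unless certified): a
RECORD entry for the measure lane (target T3); comparison scale for criterion C4
(`Summits/…/Zeta5Search/MeasureRecords.lean`, `pi_newRecord_of_exponentLE`). Nothing here is used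
as a hypothesis anywhere.
-/

noncomputable section

namespace Literature.NumberTheory.Irrationality.ZeilbergerZudilin2020

/-- **Zeilberger–Zudilin 2020** (named fact, statement only): `μ(π) ≤ 7.10320533413700172…`;
rendered as: for every exponent `p ≥ 7.103205334138`, `π` is not `p`-Liouville
(`¬ LiouvilleWith p Real.pi`).
[cite: ZeilbergerZudilin2020, Abstract and final section "World record" (μ(π) ≤ 1 + 11.613890045331…/1.90291648559998… = 7.10320533413700172…)] -/
def pi_irrationalityExponent_le : Prop :=
  ∀ p : ℝ, (7.103205334138 : ℝ) ≤ p → ¬ LiouvilleWith p Real.pi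

end Literature.NumberTheory.Irrationality.ZeilbergerZudilin2020
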